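import Literature.MathematicalPhysics.QuantumLattice.HubbardGridSliceGram
import Literature.MathematicalPhysics.QuantumLattice.HubbardShiftedCovarianceDecomposition
import HarnessLib

/-!
# The Gram constant of the infrared–plus–top part `(χ - w_{Λ₀})·p_θ` of the ultraviolet block on the time grid

Topic `MathematicalPhysics/QuantumLattice`; the constant `κ_B` of `HubbardUVBlockDetBound.isDetBoundedR_gridSub_hubbardCovTopAddUV` (cell
gate-hubbard-kl, R0-SCOPE-4 W1b).  The Gram vectors of the grid fields for the symbol `p_B = (χ_n - w_{Λ₀}(k))·p_θ(k)` (`χ` the Fejér top weight,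
`w_{Λ₀}` Salmhofer's weight above the infrared scale `Λ₀`) have

`‖F_X‖², ‖G_Y‖² = Σ_k (βL²)⁻² |χ - w_{Λ₀}| ‖p_θ‖ ≤ 8/(3π) + (1024/(3π c_{d₀})) Λ₀`,   `c_{d₀} = 2π√(d₀/8)`,

uniformly in `β, L ≥ 2β√(d₀/8)`, `M ≥ 1`, `N` and the grid points (`|θ| ≤ π/(4β)`, `0 < Λ₀ ≤ d₀/2`, `μ` at distance `≥ d₀` from `{-4,0}`):
the top part `(1-χ_n)‖p_θ‖ ≲ |n|/M · β/|2n+1|` sums to `≤ 8/(3π)` (Salmhofer 1999, §4.2.5: the sharp Matsubara edge has an `O(1)` Gram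
constant), and the infrared part `(1-w_{Λ₀})‖p_θ‖` is summed over the dyadic shells `Λ₀2^{-i-1} < |k| ≤ Λ₀2^{-i}` down to `π/β` with the slice
bound `HubbardGridSliceGram.norm_sq_gridGramF_shiftedSlice_le` (`≲ Λ_i` each; Benfatto–Giuliani–Mastropietro 2006, (2.80)).

* `abs_topWeight_sub_cutoff_le`, `norm_sq_gridGramF_le_top_add_ir` — the split `|χ - w| ≤ (1-χ) + (1-w)`;
* `sum_top_part_le` — the top part `≤ 8/(3π)`;
* `one_sub_cutoff_eq_sum_dyadic`, `sum_ir_part_le` — the dyadic telescope and its bound `≤ (1024/(3π c_{d₀})) Λ₀`;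
* **`norm_sq_gridGramF_topSubCutoff_le`**, **`norm_sq_gridGramG_topSubCutoff_le`**.

Everything is proved; no definitions, no named facts.

## Sources

M. Salmhofer, *Renormalization* (1999), §4.2.5 (4.70)–(4.71) (`Salmhofer1999`); G. Benfatto, A. Giuliani, V. Mastropietro,
Ann. Henri Poincaré 7 (2006) 809–898, §2.8 (2.80) (`BenfattoGiulianiMastropietro2006`).
-/

noncomputable section

namespace Literature.MathematicalPhysics.QuantumLattice

open Literature.Probability.LatticeModels GrassmannAlgebra Finset
open scoped InnerProductSpace

variable {L M N : ℕ} [NeZero L]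

/-! ### The split of the weight -/

omit [NeZero L] in
/-- `|χ_n - w(k)| ≤ (1 - χ_n) + (1 - w(k))` for two weights in `[0, 1]` (`0 < M`). [cite: Salmhofer1999, §4.2.5 (4.71)] -/
theorem abs_topWeight_sub_cutoff_le (hM : 0 < M) (β μ Λ₀ : ℝ) (k : FreqMomentum L M) :
    |topWeight L M k - hubbardCutoffWeight L M β μ Λ₀ k| ≤ (1 - topWeight L M k) + (1 - hubbardCutoffWeight L M β μ Λ₀ k) := by
  have h1 : 0 ≤ topWeight L M k := by
    unfold topWeight
    refine fejerWeight_nonneg hM ?_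
    have := k.1.isLt
    simp only [matsubaraInt]
    rw [abs_le]; constructor <;> omega
  have h2 : topWeight L M k ≤ 1 := fejerWeight_le_one M _
  have h3 := (salmhoferCutoff_mem_Icc ((matsubaraFreq β M k.1 ^ 2 + nambuXi L μ k.2 ^ 2) / Λ₀ ^ 2))
  rw [hubbardCutoffWeight]
  rw [abs_le]
  constructor <;> linarith [h3.1, h3.2]

/-- **The top part, termwise**: `(βL²)⁻² (1 - χ_n) ‖p_θ(k)‖ ≤ 4/(3π L² M)` (`|θ| ≤ π/(4β)`: `‖p_θ‖ ≤ (4/3)βL²/|ω_n|`, `1 - χ_n = |n|/M`,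
`|ω_n| = π|2n+1|/β ≥ π|n|/β`). [cite: Salmhofer1999, §4.2.5 (4.71)] -/
theorem top_part_term_le {β : ℝ} (hβ : 0 < β) (hM : 0 < M) (μ : ℝ) {θ : ℝ} (hθ : |θ| ≤ Real.pi / (4 * β))
    (k : FreqMomentum L M) (σ : Fin 2) :
    ‖((1 / (β * (L : ℝ) ^ 2) : ℝ) : ℂ)‖ ^ 2 * ((1 - topWeight L M k) * ‖shiftedFreeSymbol L M β μ θ (k, σ)‖) ≤
      4 / (3 * Real.pi * (L : ℝ) ^ 2 * M) := by
  have hL : (0 : ℝ) < L := by exact_mod_cast Nat.pos_of_ne_zero (NeZero.ne L)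
  have hMr : (0 : ℝ) < M := by exact_mod_cast hM
  set m : ℤ := matsubaraInt M k.1 with hm
  -- `1 - χ = |m|/M`
  have hχ : 1 - topWeight L M k = |(m : ℝ)| / M := by
    simp only [topWeight, fejerWeight, ← hm]; ring
  -- `‖p_θ‖ ≤ (4/3) βL²/|ω|` and `|ω| = π|2m+1|/β`
  have hω : |matsubaraFreq β M k.1| = Real.pi * |2 * (m : ℝ) + 1| / β := by
    rw [matsubaraFreq, ← hm, abs_div, abs_mul, abs_of_pos Real.pi_pos, abs_of_pos hβ]
  have hωpos : 0 < |matsubaraFreq β M k.1| := by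
    have := pi_div_le_abs_matsubaraFreq hβ k.1
    exact lt_of_lt_of_le (by positivity) this
  have hsym : ‖shiftedFreeSymbol L M β μ θ (k, σ)‖ ≤ 4 / 3 * (β * (L : ℝ) ^ 2) / |matsubaraFreq β M k.1| := by
    refine (norm_shiftedFreeSymbol_le hβ μ hθ (k, σ)).trans ?_
    refine div_le_div_of_nonneg_left (by positivity) hωpos ?_
    rw [← Real.sqrt_sq_eq_abs]
    exact Real.sqrt_le_sqrt (by nlinarith [sq_nonneg (nambuXi L μ k.2)])
  have hc : ‖((1 / (β * (L : ℝ) ^ 2) : ℝ) : ℂ)‖ ^ 2 = 1 / (β * (L : ℝ) ^ 2) ^ 2 := by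
    rw [Complex.norm_real, Real.norm_eq_abs, abs_of_pos (by positivity)]; ring
  -- `|m| ≤ |2m+1|`
  have hmm : |(m : ℝ)| ≤ |2 * (m : ℝ) + 1| := by
    rw [abs_le]
    rcases le_or_gt 0 m with h0 | h0
    · have : (0 : ℝ) ≤ m := by exact_mod_cast h0
      rw [abs_of_nonneg (by linarith)]; constructor <;> linarith
    · have : (m : ℝ) ≤ -1 := by exact_mod_cast (show m ≤ -1 by omega)
      rw [abs_of_neg (by linarith)]; constructor <;> linarith
  rw [hc, hχ]
  calc 1 / (β * (L : ℝ) ^ 2) ^ 2 * (|(m : ℝ)| / M * ‖shiftedFreeSymbol L M β μ θ (k, σ)‖)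
      ≤ 1 / (β * (L : ℝ) ^ 2) ^ 2 * (|(m : ℝ)| / M * (4 / 3 * (β * (L : ℝ) ^ 2) / |matsubaraFreq β M k.1|)) :=
        mul_le_mul_of_nonneg_left (mul_le_mul_of_nonneg_left hsym (by positivity)) (by positivity)
    _ = 4 / (3 * Real.pi * (L : ℝ) ^ 2 * M) * (|(m : ℝ)| / |2 * (m : ℝ) + 1|) := by
        rw [hω]; field_simp
    _ ≤ 4 / (3 * Real.pi * (L : ℝ) ^ 2 * M) * 1 := by
        refine mul_le_mul_of_nonneg_left ?_ (by positivity)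
        have h21 : (0 : ℝ) < |2 * (m : ℝ) + 1| := lt_of_lt_of_le one_pos (one_le_abs_two_mul_add_one m)
        exact (div_le_one h21).2 hmm
    _ = 4 / (3 * Real.pi * (L : ℝ) ^ 2 * M) := mul_one _

/-- **The top part**: `Σ_k (βL²)⁻² (1 - χ_n) ‖p_θ(k,σ)‖ ≤ 8/(3π)` (`2M·L²` labels). [cite: Salmhofer1999, §4.2.5 (4.71)] -/
theorem sum_top_part_le {β : ℝ} (hβ : 0 < β) (hM : 0 < M) (μ : ℝ) {θ : ℝ} (hθ : |θ| ≤ Real.pi / (4 * β)) (σ : Fin 2) :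
    ∑ k : FreqMomentum L M, ‖((1 / (β * (L : ℝ) ^ 2) : ℝ) : ℂ)‖ ^ 2 * ((1 - topWeight L M k) * ‖shiftedFreeSymbol L M β μ θ (k, σ)‖) ≤
      8 / (3 * Real.pi) := by
  have hL : (0 : ℝ) < L := by exact_mod_cast Nat.pos_of_ne_zero (NeZero.ne L)
  have hMr : (0 : ℝ) < M := by exact_mod_cast hM
  refine (sum_le_sum fun k _ => top_part_term_le hβ hM μ hθ k σ).trans ?_
  rw [sum_const, card_univ, nsmul_eq_mul]
  have hcard : (Fintype.card (FreqMomentum L M) : ℝ) = 2 * M * (L : ℝ) ^ 2 := by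
    rw [Fintype.card_prod, Fintype.card_fin, Fintype.card_pi, prod_const, ZMod.card, card_univ, Fintype.card_fin]
    push_cast; ring
  rw [hcard]
  have : (2 * M * (L : ℝ) ^ 2) * (4 / (3 * Real.pi * (L : ℝ) ^ 2 * M)) = 8 / (3 * Real.pi) := by field_simp; ring
  rw [this]

/-! ### The infrared part: dyadic shells down to `π/β` -/

omit [NeZero L] in
/-- Below the lowest frequency every weight is one: `w_Λ(k) = 1` for `0 < Λ ≤ π/β` (`ω² ≥ π²/β² ≥ Λ²`). [cite: Salmhofer1999, §4.2.5 (4.71)] -/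
theorem hubbardCutoffWeight_eq_one_of_le {β : ℝ} (hβ : 0 < β) (μ : ℝ) {Λ : ℝ} (hΛ : 0 < Λ) (hΛβ : Λ ≤ Real.pi / β)
    (k : FreqMomentum L M) : hubbardCutoffWeight L M β μ Λ k = 1 := by
  rw [hubbardCutoffWeight]
  refine salmhoferCutoff_of_ge ?_
  rw [le_div_iff₀ (by positivity), one_mul]
  have h1 := (hΛβ.trans (pi_div_le_abs_matsubaraFreq hβ k.1))
  have h2 : Λ ^ 2 ≤ matsubaraFreq β M k.1 ^ 2 := by
    rw [← sq_abs (matsubaraFreq β M k.1)]; exact pow_le_pow_left₀ hΛ.le h1 2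
  nlinarith [sq_nonneg (nambuXi L μ k.2)]

omit [NeZero L] in
/-- **The dyadic telescope**: `1 - w_{Λ₀} = Σ_{i<I} (w_{Λ₀2^{-(i+1)}} - w_{Λ₀2^{-i}})` as soon as `Λ₀ 2^{-I} ≤ π/β`.
[cite: Salmhofer1999, §4.2.5 (4.70)] -/
theorem one_sub_cutoff_eq_sum_dyadic {β : ℝ} (hβ : 0 < β) (μ : ℝ) {Λ₀ : ℝ} (hΛ₀ : 0 < Λ₀) {I : ℕ} (hI : Λ₀ / 2 ^ I ≤ Real.pi / β)
    (k : FreqMomentum L M) :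
    1 - hubbardCutoffWeight L M β μ Λ₀ k =
      ∑ i ∈ range I, (hubbardCutoffWeight L M β μ (Λ₀ / 2 ^ (i + 1)) k - hubbardCutoffWeight L M β μ (Λ₀ / 2 ^ i) k) := by
  rw [Finset.sum_range_sub fun i => hubbardCutoffWeight L M β μ (Λ₀ / 2 ^ i) k,
    hubbardCutoffWeight_eq_one_of_le hβ μ (by positivity) hI, pow_zero, div_one]

/-- **One dyadic shell**: `Σ_k (βL²)⁻² |w_{Λ/2} - w_Λ| ‖p_θ‖ ≤ (512/(3π c_{d₀})) Λ` for `π/β ≤ Λ ≤ d₀/2`, `c_{d₀} ≤ ΛL`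
(the sum is the squared Gram norm of the slice `(Λ/2, Λ]`, `HubbardGridSliceGram`). [cite: BenfattoGiulianiMastropietro2006, §2.8 (2.80)] -/
theorem dyadic_shell_le {β : ℝ} (hβ : 0 < β) {μ d₀ : ℝ} (hμ4 : d₀ ≤ μ + 4) (hμ0 : d₀ ≤ -μ) {θ : ℝ}
    (hθ : |θ| ≤ Real.pi / (4 * β)) {Λ : ℝ} (hΛβ : Real.pi / β ≤ Λ) (hΛd : Λ ≤ d₀ / 2)
    (hL : 2 * Real.pi * Real.sqrt (d₀ / 8) ≤ Λ * L) (σ : Fin 2) :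
    ∑ k : FreqMomentum L M, ‖((1 / (β * (L : ℝ) ^ 2) : ℝ) : ℂ)‖ ^ 2 *
        ‖((hubbardCutoffWeight L M β μ (Λ / 2) k : ℂ) - (hubbardCutoffWeight L M β μ Λ k : ℂ)) * shiftedFreeSymbol L M β μ θ (k, σ)‖ ≤
      512 / (3 * Real.pi * (2 * Real.pi * Real.sqrt (d₀ / 8))) * Λ := by
  have hΛ : 0 < Λ := lt_of_lt_of_le (by positivity) hΛβ
  have hL0 : (0 : ℝ) < L := by exact_mod_cast Nat.pos_of_ne_zero (NeZero.ne L)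
  have hd₀ : 0 < d₀ := by linarith
  set cd : ℝ := 2 * Real.pi * Real.sqrt (d₀ / 8) with hcd
  have hcd0 : 0 < cd := by rw [hcd]; positivity
  -- the shell sum IS the squared norm of a grid Gram vector of the slice `(Λ/2, Λ]` (one auxiliary point)
  have hid := norm_sq_gridGramF (L := L) (M := M) β (fun _ : Unit => (0 : TorusSite 2 L)) (fun _ => (0 : ℝ))
    (fun ks => ((hubbardCutoffWeight L M β μ (Λ / 2) ks.1 : ℂ) - (hubbardCutoffWeight L M β μ Λ ks.1 : ℂ)) *
      shiftedFreeSymbol L M β μ θ ks) ((((), σ), 0) : GridLeg Unit)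
  rw [← hid]
  refine (norm_sq_gridGramF_shiftedSlice_le hβ hμ4 hμ0 hθ (by positivity) (by linarith) hΛd _ _ _).trans ?_
  -- numerics
  have hc : ‖((1 / (β * (L : ℝ) ^ 2) : ℝ) : ℂ)‖ ^ 2 = 1 / (β * (L : ℝ) ^ 2) ^ 2 := by
    rw [Complex.norm_real, Real.norm_eq_abs, abs_of_pos (by positivity)]; ring
  have hΛβ' : Real.pi ≤ Λ * β := by have := (div_le_iff₀ hβ).1 hΛβ; linarith
  have hFw : Λ * β / Real.pi + 3 ≤ 4 * (Λ * β / Real.pi) := by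
    have hx : 1 ≤ Λ * β / Real.pi := by rw [one_le_div Real.pi_pos]; exact hΛβ'
    linarith only [hx]
  have hSh : (L : ℝ) * (Λ * L / cd + 1) ≤ L * (2 * (Λ * L / cd)) := by
    have hx : 1 ≤ Λ * L / cd := by rw [one_le_div hcd0]; exact hL
    exact mul_le_mul_of_nonneg_left (by linarith only [hx]) hL0.le
  rw [hc, ← hcd]
  calc 1 / (β * (L : ℝ) ^ 2) ^ 2 * ((Λ * β / Real.pi + 3) * (4 * (L * (Λ * L / cd + 1))) * (8 / 3 * (β * (L : ℝ) ^ 2) / (Λ / 2)))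
      ≤ 1 / (β * (L : ℝ) ^ 2) ^ 2 * ((4 * (Λ * β / Real.pi)) * (4 * (L * (2 * (Λ * L / cd)))) * (8 / 3 * (β * (L : ℝ) ^ 2) / (Λ / 2))) := by
        refine mul_le_mul_of_nonneg_left (mul_le_mul_of_nonneg_right (mul_le_mul hFw (by linarith only [hSh]) (by positivity)
          (by positivity)) (by positivity)) (by positivity)
    _ = 512 / (3 * Real.pi * cd) * Λ := by field_simp; ring

/-- **The infrared part**: for `I` with `Λ₀2^{-I} ≤ π/β < Λ₀ 2^{-(I-1)}` (every shell above the lowest frequency),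
`Σ_k (βL²)⁻² (1 - w_{Λ₀}(k)) ‖p_θ‖ ≤ (1024/(3π c_{d₀})) Λ₀` (`0 < Λ₀ ≤ d₀/2`, `2β√(d₀/8) ≤ L`). [cite: BenfattoGiulianiMastropietro2006, §2.8 (2.80)] -/
theorem sum_ir_part_le {β : ℝ} (hβ : 0 < β) {μ d₀ : ℝ} (hμ4 : d₀ ≤ μ + 4) (hμ0 : d₀ ≤ -μ) {θ : ℝ}
    (hθ : |θ| ≤ Real.pi / (4 * β)) {Λ₀ : ℝ} (hΛ₀ : 0 < Λ₀) (hΛ₀d : Λ₀ ≤ d₀ / 2) (hL : 2 * β * Real.sqrt (d₀ / 8) ≤ L) (σ : Fin 2) :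
    ∑ k : FreqMomentum L M, ‖((1 / (β * (L : ℝ) ^ 2) : ℝ) : ℂ)‖ ^ 2 *
        ((1 - hubbardCutoffWeight L M β μ Λ₀ k) * ‖shiftedFreeSymbol L M β μ θ (k, σ)‖) ≤
      1024 / (3 * Real.pi * (2 * Real.pi * Real.sqrt (d₀ / 8))) * Λ₀ := by
  classical
  have hd₀ : 0 < d₀ := by linarith
  set cd : ℝ := 2 * Real.pi * Real.sqrt (d₀ / 8) with hcd
  have hcd0 : 0 < cd := by rw [hcd]; positivity
  -- the number of dyadic shells above `π/β`
  have hex : ∃ I : ℕ, Λ₀ / 2 ^ I ≤ Real.pi / β := by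
    obtain ⟨I, hI⟩ := pow_unbounded_of_one_lt (Λ₀ / (Real.pi / β)) (by norm_num : (1 : ℝ) < 2)
    refine ⟨I, ?_⟩
    rw [div_le_iff₀ (by positivity)]
    have := (div_lt_iff₀ (by positivity : (0:ℝ) < Real.pi / β)).1 hI
    linarith
  set I := Nat.find hex with hIdef
  have hI : Λ₀ / 2 ^ I ≤ Real.pi / β := Nat.find_spec hex
  have hbelow : ∀ i, i < I → Real.pi / β < Λ₀ / 2 ^ i := fun i hi => not_le.1 (Nat.find_min hex hi)
  -- telescope and triangle inequality
  have htel : ∀ k : FreqMomentum L M, (1 - hubbardCutoffWeight L M β μ Λ₀ k) * ‖shiftedFreeSymbol L M β μ θ (k, σ)‖ ≤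
      ∑ i ∈ range I, ‖((hubbardCutoffWeight L M β μ (Λ₀ / 2 ^ i / 2) k : ℂ) - (hubbardCutoffWeight L M β μ (Λ₀ / 2 ^ i) k : ℂ)) *
        shiftedFreeSymbol L M β μ θ (k, σ)‖ := by
    intro k
    rw [one_sub_cutoff_eq_sum_dyadic hβ μ hΛ₀ hI k, sum_mul]
    refine (le_abs_self _).trans ((abs_sum_le_sum_abs _ _).trans (sum_le_sum fun i _ => ?_))
    rw [norm_mul, ← Complex.ofReal_sub, Complex.norm_real, Real.norm_eq_abs, abs_mul, abs_norm, pow_succ, div_mul_eq_div_div]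
  calc ∑ k : FreqMomentum L M, ‖((1 / (β * (L : ℝ) ^ 2) : ℝ) : ℂ)‖ ^ 2 *
        ((1 - hubbardCutoffWeight L M β μ Λ₀ k) * ‖shiftedFreeSymbol L M β μ θ (k, σ)‖)
      ≤ ∑ k : FreqMomentum L M, ‖((1 / (β * (L : ℝ) ^ 2) : ℝ) : ℂ)‖ ^ 2 *
          ∑ i ∈ range I, ‖((hubbardCutoffWeight L M β μ (Λ₀ / 2 ^ i / 2) k : ℂ) - (hubbardCutoffWeight L M β μ (Λ₀ / 2 ^ i) k : ℂ)) *
            shiftedFreeSymbol L M β μ θ (k, σ)‖ := sum_le_sum fun k _ => mul_le_mul_of_nonneg_left (htel k) (by positivity)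
    _ = ∑ i ∈ range I, ∑ k : FreqMomentum L M, ‖((1 / (β * (L : ℝ) ^ 2) : ℝ) : ℂ)‖ ^ 2 *
          ‖((hubbardCutoffWeight L M β μ (Λ₀ / 2 ^ i / 2) k : ℂ) - (hubbardCutoffWeight L M β μ (Λ₀ / 2 ^ i) k : ℂ)) *
            shiftedFreeSymbol L M β μ θ (k, σ)‖ := by
        rw [sum_comm]; exact sum_congr rfl fun k _ => mul_sum _ _ _
    _ ≤ ∑ i ∈ range I, 512 / (3 * Real.pi * cd) * (Λ₀ / 2 ^ i) := by
        refine sum_le_sum fun i hi => ?_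
        have hi' := hbelow i (mem_range.1 hi)
        refine dyadic_shell_le hβ hμ4 hμ0 hθ hi'.le ((div_le_self hΛ₀.le (one_le_pow₀ (by norm_num))).trans hΛ₀d) ?_ σ
        -- `cd ≤ (Λ₀/2^i) L` from `π/β < Λ₀/2^i` and `2β√(d₀/8) ≤ L`
        have h1 : 2 * Real.pi * Real.sqrt (d₀ / 8) = Real.pi / β * (2 * β * Real.sqrt (d₀ / 8)) := by field_simp
        rw [h1]
        exact mul_le_mul hi'.le hL (by positivity) (by positivity)
    _ = 512 / (3 * Real.pi * cd) * (Λ₀ * ∑ i ∈ range I, (1 / 2 : ℝ) ^ i) := by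
        rw [mul_sum, mul_sum]; exact sum_congr rfl fun i _ => by rw [one_div, inv_pow]; ring
    _ ≤ 512 / (3 * Real.pi * cd) * (Λ₀ * 2) := by
        refine mul_le_mul_of_nonneg_left (mul_le_mul_of_nonneg_left ?_ hΛ₀.le) (by positivity)
        exact (sum_geometric_two_le I)
    _ = 1024 / (3 * Real.pi * cd) * Λ₀ := by ring

/-! ### The Gram constants -/

/-- The split of the squared Gram norm into the top and the infrared parts. [cite: Salmhofer1999, §4.2.5 (4.71)] -/
theorem norm_sq_gridGram_topSubCutoff_split (hM : 0 < M) (β μ θ Λ₀ : ℝ) (σ : Fin 2) :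
    ∑ k : FreqMomentum L M, ‖((1 / (β * (L : ℝ) ^ 2) : ℝ) : ℂ)‖ ^ 2 *
        ‖((topWeight L M k - hubbardCutoffWeight L M β μ Λ₀ k : ℝ) : ℂ) * shiftedFreeSymbol L M β μ θ (k, σ)‖ ≤
      ∑ k : FreqMomentum L M, ‖((1 / (β * (L : ℝ) ^ 2) : ℝ) : ℂ)‖ ^ 2 * ((1 - topWeight L M k) * ‖shiftedFreeSymbol L M β μ θ (k, σ)‖) +
        ∑ k : FreqMomentum L M, ‖((1 / (β * (L : ℝ) ^ 2) : ℝ) : ℂ)‖ ^ 2 *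
          ((1 - hubbardCutoffWeight L M β μ Λ₀ k) * ‖shiftedFreeSymbol L M β μ θ (k, σ)‖) := by
  rw [← sum_add_distrib]
  refine sum_le_sum fun k _ => ?_
  rw [← mul_add, ← add_mul, norm_mul, Complex.norm_real (topWeight L M k - hubbardCutoffWeight L M β μ Λ₀ k),
    Real.norm_eq_abs]
  exact mul_le_mul_of_nonneg_left (mul_le_mul_of_nonneg_right (abs_topWeight_sub_cutoff_le hM β μ Λ₀ k) (norm_nonneg _))
    (by positivity)

/-- **The Gram constant of `(χ - w_{Λ₀})·p_θ` on the grid** (left vector): for `0 < β`, `0 < M`, `|θ| ≤ π/(4β)`, `μ` at distance `≥ d₀`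
from `{-4,0}`, `0 < Λ₀ ≤ d₀/2` and `2β√(d₀/8) ≤ L`,
`‖F_X‖² ≤ 8/(3π) + (1024/(3π · 2π√(d₀/8))) Λ₀`, uniformly in `N`, the grid points and `M`.
[cite: BenfattoGiulianiMastropietro2006, §2.8 (2.80)] -/
theorem norm_sq_gridGramF_topSubCutoff_le {P : Type*} {β : ℝ} (hβ : 0 < β) (hM : 0 < M) {μ d₀ : ℝ} (hμ4 : d₀ ≤ μ + 4)
    (hμ0 : d₀ ≤ -μ) {θ : ℝ} (hθ : |θ| ≤ Real.pi / (4 * β)) {Λ₀ : ℝ} (hΛ₀ : 0 < Λ₀) (hΛ₀d : Λ₀ ≤ d₀ / 2)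
    (hL : 2 * β * Real.sqrt (d₀ / 8) ≤ L) (x : P → TorusSite 2 L) (τ : P → ℝ) (X : GridLeg P) :
    ‖gridGramF L M β x τ (fun ks => ((topWeight L M ks.1 - hubbardCutoffWeight L M β μ Λ₀ ks.1 : ℝ) : ℂ) *
        shiftedFreeSymbol L M β μ θ ks) X‖ ^ 2 ≤
      8 / (3 * Real.pi) + 1024 / (3 * Real.pi * (2 * Real.pi * Real.sqrt (d₀ / 8))) * Λ₀ := by
  rw [norm_sq_gridGramF]
  exact (norm_sq_gridGram_topSubCutoff_split hM β μ θ Λ₀ X.1.2).trans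
    (add_le_add (sum_top_part_le hβ hM μ hθ X.1.2) (sum_ir_part_le hβ hμ4 hμ0 hθ hΛ₀ hΛ₀d hL X.1.2))

/-- **The Gram constant of `(χ - w_{Λ₀})·p_θ` on the grid** (right vector). [cite: BenfattoGiulianiMastropietro2006, §2.8 (2.80)] -/
theorem norm_sq_gridGramG_topSubCutoff_le {P : Type*} {β : ℝ} (hβ : 0 < β) (hM : 0 < M) {μ d₀ : ℝ} (hμ4 : d₀ ≤ μ + 4)
    (hμ0 : d₀ ≤ -μ) {θ : ℝ} (hθ : |θ| ≤ Real.pi / (4 * β)) {Λ₀ : ℝ} (hΛ₀ : 0 < Λ₀) (hΛ₀d : Λ₀ ≤ d₀ / 2)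
    (hL : 2 * β * Real.sqrt (d₀ / 8) ≤ L) (x : P → TorusSite 2 L) (τ : P → ℝ) (Y : GridLeg P) :
    ‖gridGramG L M β x τ (fun ks => ((topWeight L M ks.1 - hubbardCutoffWeight L M β μ Λ₀ ks.1 : ℝ) : ℂ) *
        shiftedFreeSymbol L M β μ θ ks) Y‖ ^ 2 ≤
      8 / (3 * Real.pi) + 1024 / (3 * Real.pi * (2 * Real.pi * Real.sqrt (d₀ / 8))) * Λ₀ := by
  rw [norm_sq_gridGramG]
  exact (norm_sq_gridGram_topSubCutoff_split hM β μ θ Λ₀ Y.1.2).trans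
    (add_le_add (sum_top_part_le hβ hM μ hθ Y.1.2) (sum_ir_part_le hβ hμ4 hμ0 hθ hΛ₀ hΛ₀d hL Y.1.2))

end Literature.MathematicalPhysics.QuantumLattice

end
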